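import Literature.MathematicalPhysics.QuantumFieldTheory.Balaban1983to89.B6CubeWindowV1
import Literature.MathematicalPhysics.QuantumFieldTheory.Balaban1983to89.B6Cover236MultiLevelTorusReachBig
import Literature.MathematicalPhysics.QuantumFieldTheory.Balaban1983to89.B6ScalarChartV1

/-!
# `Balaban1983to89.B6Line3ChiCutoffV1` — T. Bałaban, *Propagators and renormalization transformations for lattice gauge theories. II*,
# Commun. Math. Phys. **96** (1984) 223–250 [Balaban1984PropagatorsII], (2.92) p. 239 line 3 with p. 239 (*"The function ζ_□ is of the same type as h_□,
# but it is equal to 1 on a cube containing □ … and it is equal to 0 outside a similar cube"*), p. 247 (2.134): THE SITE CUT-OFF `χ_□` OF THE DOMAIN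
# CHANGE `P − P_□` IN LINE 3 — a product of one-dimensional `C^∞` plateaus around the centre of the cube in the window chart, equal to `1` on the sites of
# the blocks of `□̃` and one lattice step around them, supported `3`-deep in the member window, with first differences `O(1/S)` and second differences
# `O(1/S²)` along every axis (transition width `W = 5S/2`) — p22 g20's specification (χ1)–(χ5) (seat INBOX 2026-08-23T10:32:24Z)

statement-level skeleton of published theorems with citation tags; proofs where landed; nothing here is a claim about the Yang–Mills mass gap

PDF held: `paper:balaban1984-cmp96-propagators-rt-ii` (journal page = PDF page + 222): p. 239 [PDF 17] ((2.92)–(2.93) and the description of `ζ_□`: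
*"equal to 1 on a cube containing □ and with a boundary having the distance ⅓M to the boundary of □, and it is equal to 0 outside a similar cube with
⅓M replaced by ⅔M"*), p. 247 [PDF 25] ((2.134), Prop. 2.6); [Balaban1983RegularityDecay] §2 p. 575/577 (the cut-offs `θ_j`, their difference sizes) —
read this session from `~/.lit/texts/paper-balaban1984-cmp96-propagators-rt-ii/p0007.txt`, `p0017.txt`, `p0025.txt` and the tree transcription `…B4PartitionUnity22`
(v1.1 docfix: the difference-size attributions point to [Balaban1983RegularityDecay] p. 577 «|∂^ηh_j| ≤ O(M⁻¹), |Δ^ηh_j| ≤ O(M⁻²)» and cmp96 p. 229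
«the corresponding family of functions h described in (1.118)»; no sentence of p. 229/247 is quoted for the sizes — ref-4 D-g67-1 discipline).

CITATION HEADER (lean-in-tree rule) — WHAT IS REPRODUCED.  Phase-2 file of the `lit-balaban` typed skeleton (HOME `run/shared/lean/pub/lit-balaban/`), seat
**p38 gen 29** (literature-prover-lit-balaban-p38-g29-0): the LAST NON-BOOKKEEPING INPUT of the line-3 majorant (iv) of the k-level (2.136)₁, asked by p22 g20
(10:32:24Z, spec (χ1)–(χ5)) and confirmed by the row owner r03 (B6-CLOSURE item `hD3_cube`); SKELETON rows **B6.Eq2.92** × **B6.Eq2.134** × B6.Eq2.36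
(cells only; decls of record untouched; referee ref-4).  WHY A CUT-OFF.  Line 3 of (2.92) compares the global `∂(1 − R)∂*` with the member's `P_□` around
`supp h_□`; the by-parts engines (p38's `…B6DomainChangeP2134Sizes`, p22's `…B6Line3WindowV1.line3_window`) localise with a site function `χ` that must be
`1` on the blocks carrying `ζ_□`, `h_□` (`□̃`), vanish deep inside the member window, and have controlled first/second lattice differences.  Print's `ζ_□`
(p. 239) is such a plateau *"of the same type as h_□"*; THIS FILE builds it at the radii the chart needs from r01's `C^∞` profile `thetaProf` (`= 1` on
`|t| ≤ ¾`, `= 0` on `|t| ≥ ⅞`; `…B4PartitionUnity22`) — the PRODUCT form is essential (second differences `O(1/W²)`):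
* §1 (any box family `D′`, cube `i`, points of `ℝ^{d+1}`): `wChi = 5S/2`, **`chiR D′ i p := Π_μ θ((p_μ − ctr_μ)/W)`** (`= thetaCube W 0 (p − ctr)`),
  `0 ≤ χ ≤ 1`, **`chiR_eq_one`** (`dist(p, ctr) ≤ 15S/8`), **`dist_lt_of_chiR_ne_zero`** (`χ ≠ 0 ⇒ dist < 35S/16`), **`abs_chiR_axis_diff_le`**
  (`≤ D1 θ·|η|/W`), **`abs_chiR_axis_second_diff_le`** (`≤ D2 θ·η²/W²`);
* §2 (the canonical chart `Dch D c`, central cube `cc`, box points, TORUS neighbours `σ_{±e_μ}`): **`chiB`**, `siteDeep_of_dist_lt` (a box point within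
  `35S/16` of the centre is `3`-deep: `M_h ≥ 8`, `P_μ ≥ 5`), `chiB_tshift_eq_zero_of_not_interior`, **`abs_chiB_sub_tshift_le`** / `abs_chiB_sub_tshift_neg_le`
  (`≤ D1 θ/W`), **`abs_chiB_second_le`** (`≤ D2 θ/W²`), **`chiB_eq_one_of_near_Qbig`** (`χ = 1` on the sites of the blocks of `□̃ = Qbig` and within one
  lattice step of them: `M_h ≥ 8`, `R ≥ 3L`);
* §3 (V1 sites `x` of the chart frame, `z = toBox hN x`; p22's (χ1)–(χ5)): **`chiS`**, `chiS_nonneg`/`chiS_le_one` (χ1); **`chiS_eq_one_of_mem_Qbig`**,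
  `chiS_shift_eq_one_of_mem_Qbig`, `chiS_unshift_eq_one_of_mem_Qbig`, `chiS_eq_one_of_near_Qbig` (χ2); **`deepS_three_of_chiS_ne_zero`**,
  `deepS_two_of_near_carrier`, **`deepS_two_of_chiS_jump`** / `deepS_one_of_chiS_jump` (χ3, `L ≥ 5`); **`abs_chiS_sub_shift_le`** / **`abs_chiS_sub_unshift_le`**
  (χ4: `≤ D1 θ/(5S/2)`); **`abs_chiS_second_le`** (χ5: `≤ D2 θ/(5S/2)²`).
Constants: `C₁ = D1 thetaProf`, `C₂ = D2 thetaProf` (absolute), `W = 5S/2`, `S = bigSide ℓ M_h j`.  No `def : Prop`, no new fact; defs with bodies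
(`wChi`, `chiR`, `chiB`, `chiS`); standard axioms.

## HONEST SCOPE / DIVERGENCES

(1) Print's `ζ_□` has plateau/transition radii `⅓M`, `⅔M` beyond `□`; ours are `15S/8` (plateau) and `35S/16` (support) around the centre — the radii are
the chart's (plateau ⊇ `□̃`-blocks + 1, support `3`-deep in the window for `L ≥ 5`), the construction (product of 1-D `C^∞` plateaus) is print's *"of the
same type as h_□"*.  (2) The sizes are per axis and uniform in the site (the other factors lie in `[0, 1]`); mixed second differences are not needed by the
consumer and not stated.  (3) `M_h ≥ 8`, `P_μ ≥ 5`, `R ≥ 3L` (resp. `2L²`), `L ≥ 5` (depth `3` below the window edge `LS/2 ≥ 5S/2 ≥ 35S/16 + 3`) are this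
lane's standing thresholds, not print's.  (4) The bookkeeping to p22's `hd1/hd1'/hd2/hdb/hNχ/hχN`, the zone `N` and the depth `M₀` is the consumer's
(r03 item `hD3_cube` / p22).  Nothing on d = 4 or the continuum; NOT summit progress.  Unit `lit-balaban-p38` (gen 29), 2026-08-23.
-/

noncomputable section

open scoped BigOperators
open Finset

namespace Literature.MathematicalPhysics.QuantumFieldTheory.Balaban1983to89.B6Line3ChiCutoffV1

open LatticeFieldCalculus
open B4PartitionUnity22 (thetaProf thetaCube thetaProf_nonneg thetaProf_le_one D1 D2 D1_nonneg D2_nonneg contDiff_thetaProf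
  hasCompactSupport_thetaProf abs_thetaCube_diff_le abs_thetaCube_second_diff_le thetaCube_eq_one thetaCube_eq_zero)
open B4Reflection242 (boxDom mem_boxDom)
open B6MultiLevelBoxOperator (Domains N0 bigSide)
open B6MultiLevelTorusOperator (TDomains tshift unitVec Interior tshift_unitVec_of_interior tshift_neg_unitVec_of_interior tshift_tshift tshift_zero)
open B6Geom246MultiLevelBox (bset blkOf toR cen dist_toR_cen_le)
open B6Cover236MultiLevelBlocks (cubes side ctr side_pos)
open B6Cover236MultiLevelTorusReachBig (window_big)
open B6Partition118KLevelFineLip (Qbig mem_Qbig)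
open B6Partition118KLevelTorusChart (side_le_bigSide_k)
open B6Partition118KLevelTorusCentral (Dch cc side_cc ctr_cc_bounds level_bounds)
open B6Partition118KLevelTorusBinders (interior_of_siteDeep)
open B6TorusDepthDistance (SiteDeep)

variable {d : ℕ} {ℓ Mh k R : ℕ} {P : Fin (d + 1) → ℕ}

/-! ## §1  The product plateau around the centre of a cube, at points of `ℝ^{d+1}` -/

section Real

variable (D' : Domains d ℓ Mh k P R)

/-- **THE TRANSITION SCALE `W = 5S/2`** of the cut-off (`θ = 1` on `|t| ≤ ¾`, `= 0` on `|t| ≥ ⅞`: plateau radius `15S/8`, support radius `35S/16`).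
[cite: Balaban1984PropagatorsII, p.239 («equal to 1 on a cube containing □ … equal to 0 outside a similar cube»), dictionary (radii ours)] -/
def wChi (i : ↥(cubes D')) : ℝ := 5 / 2 * side D' i

/-- `W = 5S/2`, unfolded. [cite: Balaban1984PropagatorsII, p.239, bookkeeping] -/
theorem wChi_eq (i : ↥(cubes D')) : wChi D' i = 5 / 2 * side D' i := rfl

/-- `W > 0`. [cite: Balaban1984PropagatorsII, p.239, bookkeeping] -/
theorem wChi_pos (hMh : 1 ≤ Mh) (i : ↥(cubes D')) : 0 < wChi D' i := by
  unfold wChi; exact mul_pos (by norm_num) (side_pos D' hMh i)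

/-- **THE CUT-OFF `χ_□` AT REAL POINTS**: `Π_μ θ((p_μ − ctr_μ)/W)` with r01's `C^∞` plateau `θ = thetaProf` — *"of the same type as h_□"* (a product of
one-dimensional profiles). [cite: Balaban1984PropagatorsII, p.239; Balaban1983RegularityDecay, §2 p.575] -/
def chiR (i : ↥(cubes D')) (p : Fin (d + 1) → ℝ) : ℝ := ∏ μ, thetaProf ((p μ - ctr D' i μ) / wChi D' i)

/-- the cut-off is r01's `θ_j` (`thetaCube`) at scale `W`, label `0`, recentred at `ctr`. [cite: Balaban1983RegularityDecay, §2 p.575, dictionary] -/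
theorem chiR_eq_thetaCube (i : ↥(cubes D')) (p : Fin (d + 1) → ℝ) :
    chiR D' i p = thetaCube (wChi D' i) (0 : Fin (d + 1) → ℤ) (fun μ => p μ - ctr D' i μ) := by
  unfold chiR thetaCube
  simp

/-- `χ ≥ 0`. [cite: Balaban1984PropagatorsII, p.239, bookkeeping] -/
theorem chiR_nonneg (i : ↥(cubes D')) (p : Fin (d + 1) → ℝ) : 0 ≤ chiR D' i p :=
  Finset.prod_nonneg fun _ _ => thetaProf_nonneg _

/-- `χ ≤ 1`. [cite: Balaban1984PropagatorsII, p.239, bookkeeping] -/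
theorem chiR_le_one (i : ↥(cubes D')) (p : Fin (d + 1) → ℝ) : chiR D' i p ≤ 1 :=
  Finset.prod_le_one (fun _ _ => thetaProf_nonneg _) fun _ _ => thetaProf_le_one _

/-- **`χ_□ = 1` WITHIN `15S/8` OF THE CENTRE** (*"equal to 1 on a cube containing □"*). [cite: Balaban1984PropagatorsII, p.239] -/
theorem chiR_eq_one (hMh : 1 ≤ Mh) {i : ↥(cubes D')} {p : Fin (d + 1) → ℝ} (h : dist p (ctr D' i) ≤ 15 / 8 * side D' i) :
    chiR D' i p = 1 := by
  rw [chiR_eq_thetaCube]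
  refine thetaCube_eq_one (wChi_pos D' hMh i) fun μ => ?_
  simp only [Pi.zero_apply, Int.cast_zero, mul_zero, sub_zero]
  have hμ := dist_le_pi_dist p (ctr D' i) μ
  rw [Real.dist_eq] at hμ
  unfold wChi; linarith

/-- **`χ_□ ≠ 0` ONLY WITHIN `35S/16` OF THE CENTRE** (*"equal to 0 outside a similar cube"*). [cite: Balaban1984PropagatorsII, p.239] -/
theorem dist_lt_of_chiR_ne_zero (hMh : 1 ≤ Mh) {i : ↥(cubes D')} {p : Fin (d + 1) → ℝ} (h : chiR D' i p ≠ 0) :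
    dist p (ctr D' i) < 35 / 16 * side D' i := by
  have hS := side_pos D' hMh i
  refine (dist_pi_lt_iff (mul_pos (by norm_num) hS)).2 fun μ => ?_
  by_contra hge
  apply h
  rw [chiR_eq_thetaCube]
  refine thetaCube_eq_zero (wChi_pos D' hMh i) (μ := μ) ?_
  simp only [Pi.zero_apply, Int.cast_zero, mul_zero, sub_zero]
  rw [Real.dist_eq, not_lt] at hge
  unfold wChi; linarith

/-- the cut-off after a move of one coordinate, as `θ_j` of the recentred point. [folklore] -/
private theorem chiR_update (i : ↥(cubes D')) (p : Fin (d + 1) → ℝ) (μ : Fin (d + 1)) (v : ℝ) :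
    chiR D' i (Function.update p μ v) =
      thetaCube (wChi D' i) (0 : Fin (d + 1) → ℤ) (Function.update (fun ν => p ν - ctr D' i ν) μ (v - ctr D' i μ)) := by
  rw [chiR_eq_thetaCube]
  congr 1
  funext ν
  by_cases hν : ν = μ
  · subst hν; simp
  · simp [Function.update_of_ne hν]

/-- **FIRST DIFFERENCES ALONG AN AXIS: `|χ_□(p + ηe_μ) − χ_□(p)| ≤ D1 θ·|η|/W`** (the other factors lie in `[0, 1]`).
[cite: Balaban1983RegularityDecay, §2 p.577 («|∂^ηh_j| ≤ O(M⁻¹)»: the same mean-value estimate, applied to θ), p.575; Balaban1984PropagatorsII, p.239] -/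
theorem abs_chiR_axis_diff_le (hMh : 1 ≤ Mh) (i : ↥(cubes D')) (p : Fin (d + 1) → ℝ) (μ : Fin (d + 1)) (η : ℝ) :
    |chiR D' i (Function.update p μ (p μ + η)) - chiR D' i p| ≤ D1 thetaProf * |η| / wChi D' i := by
  have h := abs_thetaCube_diff_le (wChi_pos D' hMh i) (0 : Fin (d + 1) → ℤ) (fun ν => p ν - ctr D' i ν) μ η
  rw [chiR_update, chiR_eq_thetaCube D' i p]
  have e : p μ + η - ctr D' i μ = p μ - ctr D' i μ + η := by ring
  rw [e]
  exact h

/-- **SECOND DIFFERENCES ALONG AN AXIS: `|χ_□(p + ηe_μ) − 2χ_□(p) + χ_□(p − ηe_μ)| ≤ D2 θ·η²/W²`.**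
[cite: Balaban1983RegularityDecay, §2 p.577 («|Δ^ηh_j| ≤ O(M⁻²)»: the same second-order estimate, applied to θ), p.575; Balaban1984PropagatorsII, p.239] -/
theorem abs_chiR_axis_second_diff_le (i : ↥(cubes D')) (p : Fin (d + 1) → ℝ) (μ : Fin (d + 1)) (η : ℝ) :
    |chiR D' i (Function.update p μ (p μ + η)) - 2 * chiR D' i p + chiR D' i (Function.update p μ (p μ - η))|
      ≤ D2 thetaProf * η ^ 2 / wChi D' i ^ 2 := by
  have h := abs_thetaCube_second_diff_le (wChi D' i) (0 : Fin (d + 1) → ℤ) (fun ν => p ν - ctr D' i ν) μ η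
  rw [chiR_update, chiR_update, chiR_eq_thetaCube D' i p]
  have e1 : p μ + η - ctr D' i μ = p μ - ctr D' i μ + η := by ring
  have e2 : p μ - η - ctr D' i μ = p μ - ctr D' i μ - η := by ring
  rw [e1, e2]
  exact h

end Real

/-! ## §2  Box points of the canonical chart: depth, torus neighbours, the plateau over `□̃` -/

section Box

variable {D : TDomains d ℓ Mh k P R} (hMh1 : 1 ≤ Mh) (hP4 : ∀ μ, 4 ≤ P μ) (c : ↥(cubes D.toDomains))

/-- **THE CUT-OFF OF THE CENTRAL CUBE AT BOX POINTS** of the canonical chart `Dch D c` (side `S = S_j`, `j` the level of `c`).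
[cite: Balaban1984PropagatorsII, p.239, (2.36) p.229, dictionary (charts)] -/
def chiB (z : ↥(boxDom (N0 ℓ Mh k P))) : ℝ := chiR (Dch D c) (cc D hMh1 hP4 c) (toR z.1)

/-- unfolding. [cite: Balaban1984PropagatorsII, p.239, dictionary] -/
theorem chiB_apply (z : ↥(boxDom (N0 ℓ Mh k P))) : chiB hMh1 hP4 c z = chiR (Dch D c) (cc D hMh1 hP4 c) (toR z.1) := rfl

/-- `0 ≤ χ`. [cite: Balaban1984PropagatorsII, p.239, bookkeeping] -/
theorem chiB_nonneg (z : ↥(boxDom (N0 ℓ Mh k P))) : 0 ≤ chiB hMh1 hP4 c z := chiR_nonneg _ _ _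

/-- `χ ≤ 1`. [cite: Balaban1984PropagatorsII, p.239, bookkeeping] -/
theorem chiB_le_one (z : ↥(boxDom (N0 ℓ Mh k P))) : chiB hMh1 hP4 c z ≤ 1 := chiR_le_one _ _ _

/-- the transition scale of the central cube is `5S_j/2`. [cite: Balaban1984PropagatorsII, p.239, bookkeeping] -/
theorem wChi_cc : wChi (Dch D c) (cc D hMh1 hP4 c) = 5 / 2 * (bigSide ℓ Mh c.1.1 : ℝ) := by unfold wChi; rw [side_cc]

/-- `S_j ≥ 8` for `M_h ≥ 8`. [folklore] -/
private theorem eight_le_bigSide (hM8 : 8 ≤ Mh) (j : ℕ) : (8 : ℝ) ≤ (bigSide ℓ Mh j : ℝ) := by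
  have h : 8 * 1 ≤ bigSide ℓ Mh j := by
    unfold bigSide; exact Nat.mul_le_mul hM8 (Nat.one_le_pow _ _ (Nat.succ_pos ℓ))
  exact_mod_cast h

/-- `L^i ≤ S_j/8` for `i ≤ j + 1`, `M_h ≥ 8`. [folklore] -/
private theorem pow_le_eighth_bigSide (hM8 : 8 ≤ Mh) {i j : ℕ} (hij : i ≤ j + 1) : (((ℓ + 1) ^ i : ℕ) : ℝ) ≤ (bigSide ℓ Mh j : ℝ) / 8 := by
  have h1 : (((ℓ + 1) ^ i : ℕ) : ℝ) ≤ (((ℓ + 1) ^ (j + 1) : ℕ) : ℝ) := by exact_mod_cast Nat.pow_le_pow_right (Nat.succ_pos ℓ) hij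
  have hM : (8 : ℝ) ≤ Mh := by exact_mod_cast hM8
  have e : (bigSide ℓ Mh j : ℝ) = (Mh : ℝ) * (((ℓ + 1) ^ (j + 1) : ℕ) : ℝ) := by unfold bigSide; push_cast; ring
  rw [e]
  have h0 : (0 : ℝ) ≤ (((ℓ + 1) ^ (j + 1) : ℕ) : ℝ) := by positivity
  nlinarith

/-- **A BOX POINT WITHIN `35S/16` OF THE CENTRE OF THE CENTRAL CUBE IS `3`-DEEP** (`M_h ≥ 8`, `P_μ ≥ 5`: the centre is at least `2S_k + S/2` from every
wall and `2S_k + S/2 − 35S/16 ≥ 5S_k/16 > 2`). [cite: Balaban1984PropagatorsII, (2.36) p.229, dictionary (charts)] -/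
theorem siteDeep_of_dist_lt (hM8 : 8 ≤ Mh) (hP5 : ∀ μ, 5 ≤ P μ) {z : Fin (d + 1) → ℤ}
    (h : dist (toR z) (ctr (Dch D c) (cc D hMh1 hP4 c)) < 35 / 16 * (bigSide ℓ Mh c.1.1 : ℝ)) :
    SiteDeep (N0 ℓ Mh k P) 3 z := by
  intro μ
  obtain ⟨h1, h2⟩ := ctr_cc_bounds hMh1 hP4 c μ
  have hP : (5 : ℝ) ≤ P μ := by exact_mod_cast hP5 μ
  have hμ := (dist_le_pi_dist (toR z) _ μ).trans_lt h
  rw [Real.dist_eq, abs_lt] at hμ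
  have ex : toR z μ = (z μ : ℝ) := rfl
  rw [ex] at hμ
  obtain ⟨hμ1, hμ2⟩ := hμ
  have hS : (bigSide ℓ Mh c.1.1 : ℝ) ≤ (bigSide ℓ Mh k : ℝ) := by rw [← side_cc hMh1 hP4 c]; exact side_le_bigSide_k _ _
  have hSk : (8 : ℝ) ≤ (bigSide ℓ Mh k : ℝ) := eight_le_bigSide hM8 k
  have hS0 : (0 : ℝ) ≤ (bigSide ℓ Mh k : ℝ) := by linarith
  have hlo' : (2 : ℝ) < (z μ : ℝ) := by nlinarith
  have hhi' : (z μ : ℝ) + 2 < (N0 ℓ Mh k P μ : ℝ) := by nlinarith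
  have hlo : (2 : ℤ) < z μ := by exact_mod_cast hlo'
  have hhi : z μ + 2 < ((N0 ℓ Mh k P μ : ℕ) : ℤ) := by exact_mod_cast hhi'
  constructor <;> omega

/-- `χ ≠ 0` at a box point forces depth `3`. [cite: Balaban1984PropagatorsII, p.239, (2.36) p.229, bookkeeping] -/
theorem siteDeep_three_of_chiB_ne_zero (hM8 : 8 ≤ Mh) (hP5 : ∀ μ, 5 ≤ P μ) {z : ↥(boxDom (N0 ℓ Mh k P))} (h : chiB hMh1 hP4 c z ≠ 0) :
    SiteDeep (N0 ℓ Mh k P) 3 z.1 := by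
  have hd := dist_lt_of_chiR_ne_zero (Dch D c) hMh1 h
  rw [side_cc] at hd
  exact siteDeep_of_dist_lt hMh1 hP4 c hM8 hP5 hd

/-- `χ ≠ 0` at a box point makes it interior. [cite: Balaban1984PropagatorsII, p.239, (2.36) p.229, bookkeeping] -/
theorem interior_of_chiB_ne_zero (hM8 : 8 ≤ Mh) (hP5 : ∀ μ, 5 ≤ P μ) {z : ↥(boxDom (N0 ℓ Mh k P))} (h : chiB hMh1 hP4 c z ≠ 0) :
    Interior (N0 ℓ Mh k P) z :=
  interior_of_siteDeep ((siteDeep_three_of_chiB_ne_zero hMh1 hP4 c hM8 hP5 h).mono (by norm_num))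

/-- at a non-interior box point no torus neighbour `σ_{±e_μ} z` carries `χ` (carriers are `3`-deep; `z = σ_{∓e_μ}(σ_{±e_μ} z)` would be interior).
[cite: Balaban1984PropagatorsII, p.239, (2.36) p.229, bookkeeping] -/
theorem chiB_tshift_eq_zero_of_not_interior (hM8 : 8 ≤ Mh) (hP5 : ∀ μ, 5 ≤ P μ) {z : ↥(boxDom (N0 ℓ Mh k P))}
    (hint : ¬ Interior (N0 ℓ Mh k P) z) (μ : Fin (d + 1)) :
    chiB hMh1 hP4 c (tshift (N0 ℓ Mh k P) (unitVec μ) z) = 0 ∧ chiB hMh1 hP4 c (tshift (N0 ℓ Mh k P) (-unitVec μ) z) = 0 := by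
  constructor
  · by_contra h
    have hd := siteDeep_three_of_chiB_ne_zero hMh1 hP4 c hM8 hP5 h
    have hi : Interior (N0 ℓ Mh k P) (tshift (N0 ℓ Mh k P) (unitVec μ) z) := interior_of_siteDeep (hd.mono (by norm_num))
    have hval := tshift_neg_unitVec_of_interior hi μ
    have ex : tshift (N0 ℓ Mh k P) (-unitVec μ) (tshift (N0 ℓ Mh k P) (unitVec μ) z) = z := by
      rw [tshift_tshift, add_neg_cancel, tshift_zero]
    rw [ex] at hval
    apply hint
    intro i
    obtain ⟨h3, h4⟩ := hd i
    rw [hval, Pi.sub_apply]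
    by_cases hiμ : i = μ
    · subst hiμ; rw [Pi.single_eq_same]; omega
    · rw [Pi.single_eq_of_ne hiμ]; omega
  · by_contra h
    have hd := siteDeep_three_of_chiB_ne_zero hMh1 hP4 c hM8 hP5 h
    have hi : Interior (N0 ℓ Mh k P) (tshift (N0 ℓ Mh k P) (-unitVec μ) z) := interior_of_siteDeep (hd.mono (by norm_num))
    have hval := tshift_unitVec_of_interior hi μ
    have ex : tshift (N0 ℓ Mh k P) (unitVec μ) (tshift (N0 ℓ Mh k P) (-unitVec μ) z) = z := by
      rw [tshift_tshift, neg_add_cancel, tshift_zero]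
    rw [ex] at hval
    apply hint
    intro i
    obtain ⟨h3, h4⟩ := hd i
    rw [hval, Pi.add_apply]
    by_cases hiμ : i = μ
    · subst hiμ; rw [Pi.single_eq_same]; omega
    · rw [Pi.single_eq_of_ne hiμ]; omega

/-- integer axis moves read in `ℝ^{d+1}`. [folklore] -/
private theorem toR_add_single (x : Fin (d + 1) → ℤ) (μ : Fin (d + 1)) (t : ℤ) :
    toR (x + Pi.single μ t) = Function.update (toR x) μ (toR x μ + t) := by
  funext ν
  by_cases h : ν = μ
  · subst h; simp [toR]
  · simp [toR, Function.update_of_ne h, Pi.single_eq_of_ne h]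

/-- integer axis moves read in `ℝ^{d+1}`, backwards. [folklore] -/
private theorem toR_sub_single (x : Fin (d + 1) → ℤ) (μ : Fin (d + 1)) (t : ℤ) :
    toR (x - Pi.single μ t) = Function.update (toR x) μ (toR x μ - t) := by
  funext ν
  by_cases h : ν = μ
  · subst h; simp [toR]
  · simp [toR, Function.update_of_ne h, Pi.single_eq_of_ne h]

/-- a lattice move of one coordinate has length `≤ 1` (in fact `= |t|` for `t = ±1`). [folklore] -/
private theorem dist_update_le (f : Fin (d + 1) → ℝ) (μ : Fin (d + 1)) {t : ℝ} (ht : |t| ≤ 1) :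
    dist (Function.update f μ (f μ + t)) f ≤ 1 := by
  refine (dist_pi_le_iff zero_le_one).2 fun ν => ?_
  by_cases h : ν = μ
  · subst h
    rw [Function.update_self, Real.dist_eq]
    have e : f ν + t - f ν = t := by ring
    rw [e]; exact ht
  · rw [Function.update_of_ne h, dist_self]; exact zero_le_one

/-- at an interior point the torus neighbours are at box distance `≤ 1`. [cite: Balaban1983RegularityDecay, p.572 (periodic conditions), dictionary] -/
theorem dist_toR_tshift_le_one {z : ↥(boxDom (N0 ℓ Mh k P))} (hint : Interior (N0 ℓ Mh k P) z) (μ : Fin (d + 1)) :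
    dist (toR (tshift (N0 ℓ Mh k P) (unitVec μ) z).1) (toR z.1) ≤ 1 ∧ dist (toR (tshift (N0 ℓ Mh k P) (-unitVec μ) z).1) (toR z.1) ≤ 1 := by
  constructor
  · rw [tshift_unitVec_of_interior hint μ, toR_add_single]
    exact dist_update_le _ μ (by simp)
  · rw [tshift_neg_unitVec_of_interior hint μ, toR_sub_single, sub_eq_add_neg]
    exact dist_update_le _ μ (by simp)

/-- **FIRST DIFFERENCE WITH THE FORWARD TORUS NEIGHBOUR: `|χ(z) − χ(σ_{e_μ} z)| ≤ D1 θ/W`** (`W = 5S/2`; interior: the lattice move; at the walls both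
values vanish). [cite: Balaban1984PropagatorsII, p.239 (ζ_□ «of the same type as h_□»), p.229 («the corresponding family of functions h described in (1.118)»); Balaban1983RegularityDecay, §2 p.577] -/
theorem abs_chiB_sub_tshift_le (hM8 : 8 ≤ Mh) (hP5 : ∀ μ, 5 ≤ P μ) (μ : Fin (d + 1)) (z : ↥(boxDom (N0 ℓ Mh k P))) :
    |chiB hMh1 hP4 c z - chiB hMh1 hP4 c (tshift (N0 ℓ Mh k P) (unitVec μ) z)| ≤ D1 thetaProf / (5 / 2 * (bigSide ℓ Mh c.1.1 : ℝ)) := by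
  rw [abs_sub_comm, ← wChi_cc hMh1 hP4 c]
  by_cases hint : Interior (N0 ℓ Mh k P) z
  · rw [chiB_apply, chiB_apply, tshift_unitVec_of_interior hint μ, toR_add_single]
    have h := abs_chiR_axis_diff_le (Dch D c) hMh1 (cc D hMh1 hP4 c) (toR z.1) μ ((1 : ℤ) : ℝ)
    simpa using h
  · have h0 : chiB hMh1 hP4 c z = 0 := by
      by_contra h; exact hint (interior_of_chiB_ne_zero hMh1 hP4 c hM8 hP5 h)
    rw [(chiB_tshift_eq_zero_of_not_interior hMh1 hP4 c hM8 hP5 hint μ).1, h0, sub_zero, abs_zero]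
    exact div_nonneg (D1_nonneg contDiff_thetaProf hasCompactSupport_thetaProf) (le_of_lt (wChi_pos _ hMh1 _))

/-- **FIRST DIFFERENCE WITH THE BACKWARD TORUS NEIGHBOUR: `|χ(z) − χ(σ_{−e_μ} z)| ≤ D1 θ/W`.** [cite: Balaban1984PropagatorsII, p.239, p.229] -/
theorem abs_chiB_sub_tshift_neg_le (hM8 : 8 ≤ Mh) (hP5 : ∀ μ, 5 ≤ P μ) (μ : Fin (d + 1)) (z : ↥(boxDom (N0 ℓ Mh k P))) :
    |chiB hMh1 hP4 c z - chiB hMh1 hP4 c (tshift (N0 ℓ Mh k P) (-unitVec μ) z)| ≤ D1 thetaProf / (5 / 2 * (bigSide ℓ Mh c.1.1 : ℝ)) := by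
  rw [abs_sub_comm, ← wChi_cc hMh1 hP4 c]
  by_cases hint : Interior (N0 ℓ Mh k P) z
  · rw [chiB_apply, chiB_apply, tshift_neg_unitVec_of_interior hint μ, toR_sub_single]
    have h := abs_chiR_axis_diff_le (Dch D c) hMh1 (cc D hMh1 hP4 c) (toR z.1) μ (-((1 : ℤ) : ℝ))
    rw [← sub_eq_add_neg] at h
    simpa using h
  · have h0 : chiB hMh1 hP4 c z = 0 := by
      by_contra h; exact hint (interior_of_chiB_ne_zero hMh1 hP4 c hM8 hP5 h)
    rw [(chiB_tshift_eq_zero_of_not_interior hMh1 hP4 c hM8 hP5 hint μ).2, h0, sub_zero, abs_zero]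
    exact div_nonneg (D1_nonneg contDiff_thetaProf hasCompactSupport_thetaProf) (le_of_lt (wChi_pos _ hMh1 _))

/-- **SECOND DIFFERENCE WITH THE TORUS NEIGHBOURS: `|χ(σ_{e_μ} z) − 2χ(z) + χ(σ_{−e_μ} z)| ≤ D2 θ/W²`.**
[cite: Balaban1984PropagatorsII, p.239 (ζ_□ «of the same type as h_□»), p.229 («the corresponding family of functions h described in (1.118)»); Balaban1983RegularityDecay, §2 p.577] -/
theorem abs_chiB_second_le (hM8 : 8 ≤ Mh) (hP5 : ∀ μ, 5 ≤ P μ) (μ : Fin (d + 1)) (z : ↥(boxDom (N0 ℓ Mh k P))) :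
    |chiB hMh1 hP4 c (tshift (N0 ℓ Mh k P) (unitVec μ) z) - 2 * chiB hMh1 hP4 c z + chiB hMh1 hP4 c (tshift (N0 ℓ Mh k P) (-unitVec μ) z)|
      ≤ D2 thetaProf / (5 / 2 * (bigSide ℓ Mh c.1.1 : ℝ)) ^ 2 := by
  rw [← wChi_cc hMh1 hP4 c]
  by_cases hint : Interior (N0 ℓ Mh k P) z
  · rw [chiB_apply, chiB_apply, chiB_apply, tshift_unitVec_of_interior hint μ, tshift_neg_unitVec_of_interior hint μ,
      toR_add_single, toR_sub_single]
    have h := abs_chiR_axis_second_diff_le (Dch D c) (cc D hMh1 hP4 c) (toR z.1) μ ((1 : ℤ) : ℝ)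
    simpa using h
  · have h0 : chiB hMh1 hP4 c z = 0 := by
      by_contra h; exact hint (interior_of_chiB_ne_zero hMh1 hP4 c hM8 hP5 h)
    obtain ⟨hp, hm⟩ := chiB_tshift_eq_zero_of_not_interior hMh1 hP4 c hM8 hP5 hint μ
    rw [hp, hm, h0, mul_zero, sub_zero, add_zero, abs_zero]
    exact div_nonneg (D2_nonneg contDiff_thetaProf hasCompactSupport_thetaProf) (sq_nonneg _)

/-- **A SITE OF A BLOCK OF `□̃` IS WITHIN `29S/16 − ½` OF THE CENTRE** (`M_h ≥ 8`, `R ≥ 3L`): the block has its centre within `7S/4` and level `≤ j + 1`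
(`window_big`), hence radius `≤ (L^{j+1} − 1)/2 ≤ S/16 − ½`. [cite: Balaban1984PropagatorsII, p.239 (□̃), p.235] -/
theorem dist_ctr_le_of_mem_Qbig (hM8 : 8 ≤ Mh) (hR : 3 * (ℓ + 1) ≤ R) {z : ↥(boxDom (N0 ℓ Mh k P))}
    (hz : blkOf (Dch D c) z ∈ Qbig (Dch D c) (cc D hMh1 hP4 c)) :
    dist (toR z.1) (ctr (Dch D c) (cc D hMh1 hP4 c)) ≤ 29 / 16 * (bigSide ℓ Mh c.1.1 : ℝ) - 1 / 2 := by
  have hcen := (mem_Qbig (Dch D c)).1 hz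
  rw [side_cc] at hcen
  have hlev : (blkOf (Dch D c) z).1.1 ≤ c.1.1 + 1 := (window_big (Dch D c) hMh1 hR hz).2
  have hsite := dist_toR_cen_le (Dch D c) (rfl : blkOf (Dch D c) z = blkOf (Dch D c) z)
  have hpow := pow_le_eighth_bigSide (ℓ := ℓ) hM8 hlev
  linarith [dist_triangle (toR z.1) (cen (Dch D c) (blkOf (Dch D c) z)) (ctr (Dch D c) (cc D hMh1 hP4 c))]

/-- **`χ_□ = 1` ON THE SITES OF THE BLOCKS OF `□̃` AND WITHIN ONE LATTICE STEP OF THEM** (`M_h ≥ 8`, `R ≥ 3L`): `29S/16 − ½ + 1 ≤ 15S/8`.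
[cite: Balaban1984PropagatorsII, p.239 («equal to 1 on a cube containing □»)] -/
theorem chiB_eq_one_of_near_Qbig (hM8 : 8 ≤ Mh) (hR : 3 * (ℓ + 1) ≤ R) {z z' : ↥(boxDom (N0 ℓ Mh k P))}
    (hz : blkOf (Dch D c) z ∈ Qbig (Dch D c) (cc D hMh1 hP4 c)) (hnear : dist (toR z'.1) (toR z.1) ≤ 1) :
    chiB hMh1 hP4 c z' = 1 := by
  refine chiR_eq_one (Dch D c) hMh1 ?_
  rw [side_cc]
  have h1 := dist_ctr_le_of_mem_Qbig hMh1 hP4 c hM8 hR hz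
  have hS8 := eight_le_bigSide (ℓ := ℓ) hM8 c.1.1
  linarith [dist_triangle (toR z'.1) (toR z.1) (ctr (Dch D c) (cc D hMh1 hP4 c))]

/-- a site of a block of `□̃` is interior (indeed `3`-deep). [cite: Balaban1984PropagatorsII, p.239 (□̃), (2.36) p.229, bookkeeping] -/
theorem interior_of_mem_Qbig (hM8 : 8 ≤ Mh) (hR : 3 * (ℓ + 1) ≤ R) (hP5 : ∀ μ, 5 ≤ P μ) {z : ↥(boxDom (N0 ℓ Mh k P))}
    (hz : blkOf (Dch D c) z ∈ Qbig (Dch D c) (cc D hMh1 hP4 c)) : Interior (N0 ℓ Mh k P) z := by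
  have h1 := dist_ctr_le_of_mem_Qbig hMh1 hP4 c hM8 hR hz
  have hS8 := eight_le_bigSide (ℓ := ℓ) hM8 c.1.1
  exact interior_of_siteDeep ((siteDeep_of_dist_lt hMh1 hP4 c hM8 hP5 (z := z.1) (by linarith)).mono (by norm_num))

end Box

/-! ## §3  V1 sites of the chart frame: p22's (χ1)–(χ5) -/

section Sites

open B6GlobalChartV1 (PV toBox)
open B6ScalarChartV1 (toBox_shift toBox_unshift)
open B6AgreeLapV1Chart (DeepS deepS_mono)
open B6MemberOfCubeV1 (bare)
open B6CubeWindowV1 (eC x0 j0 j0_hj deep_of_dist_le)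
open B10StarCount (unshift_shift)

variable {hd : 1 ≤ d + 1} {hL : Odd (ℓ + 1) ∧ 1 < ℓ + 1} {a₀ a₁ : ℝ} {m K : ℕ} {P' : Fin (d + 1) → ℕ}
variable (hN : ∀ μ, N0 ℓ Mh k P' μ = (PV d ℓ m K hd hL).sitesPerDir 0) {D : TDomains d ℓ Mh k P' R}
  (hMh1 : 1 ≤ Mh) (hP4 : ∀ μ, 4 ≤ P' μ) {a : ℕ} (hMha : Mh = (ℓ + 1) ^ a) (c : ↥(cubes D.toDomains)) (ha : a₀ ≤ a₁)

/-- **THE SITE CUT-OFF `χ_□` OF THE DOMAIN CHANGE** on the V1 sites of the chart frame of the cube `c`: `χ_□(x) := Π_μ θ((z_μ − ctr_μ)/(5S/2))`,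
`z = toBox x`. [cite: Balaban1984PropagatorsII, (2.92) p.239 line 3, p.239 (ζ_□), dictionary (charts)] -/
def chiS (x : Site (PV d ℓ m K hd hL) 0) : ℝ := chiB hMh1 hP4 c (toBox hN x)

/-- unfolding. [cite: Balaban1984PropagatorsII, p.239, dictionary] -/
theorem chiS_apply (x : Site (PV d ℓ m K hd hL) 0) : chiS hN hMh1 hP4 c x = chiR (Dch D c) (cc D hMh1 hP4 c) (toR (toBox hN x).1) := rfl

/-- unfolding to the box cut-off. [cite: Balaban1984PropagatorsII, p.239, dictionary] -/
theorem chiS_eq_chiB (x : Site (PV d ℓ m K hd hL) 0) : chiS hN hMh1 hP4 c x = chiB hMh1 hP4 c (toBox hN x) := rfl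

/-- (χ1) `0 ≤ χ`. [cite: Balaban1984PropagatorsII, p.239, bookkeeping] -/
theorem chiS_nonneg (x : Site (PV d ℓ m K hd hL) 0) : 0 ≤ chiS hN hMh1 hP4 c x := chiR_nonneg _ _ _

/-- (χ1) `χ ≤ 1`. [cite: Balaban1984PropagatorsII, p.239, bookkeeping] -/
theorem chiS_le_one (x : Site (PV d ℓ m K hd hL) 0) : chiS hN hMh1 hP4 c x ≤ 1 := chiR_le_one _ _ _

/-- (χ1) `|χ| ≤ 1`. [cite: Balaban1984PropagatorsII, p.239, bookkeeping] -/
theorem abs_chiS_le_one (x : Site (PV d ℓ m K hd hL) 0) : |chiS hN hMh1 hP4 c x| ≤ 1 := by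
  rw [abs_of_nonneg (chiS_nonneg hN hMh1 hP4 c x)]; exact chiS_le_one hN hMh1 hP4 c x

/-- (χ2, radius form) `χ = 1` within `15S/8` of the centre. [cite: Balaban1984PropagatorsII, p.239 («equal to 1 on a cube containing □»)] -/
theorem chiS_eq_one_of_dist_le {x : Site (PV d ℓ m K hd hL) 0}
    (h : dist (toR (toBox hN x).1) (ctr (Dch D c) (cc D hMh1 hP4 c)) ≤ 15 / 8 * (bigSide ℓ Mh c.1.1 : ℝ)) : chiS hN hMh1 hP4 c x = 1 :=
  chiR_eq_one (Dch D c) hMh1 (by rw [side_cc]; exact h)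

/-- **(χ2) `χ_□ = 1` NEAR THE `□̃`-BLOCKS** (`M_h ≥ 8`, `R ≥ 3L`): if the chart block of `x` lies in `Qbig` (the chart-frame `□̃`, radius `7S/4` — the blocks
carrying `ζ_□`, `h_□`) and `x′` is within box distance `1` of `x`, then `χ(x′) = 1`. [cite: Balaban1984PropagatorsII, p.239, p.247] -/
theorem chiS_eq_one_of_near_Qbig (hM8 : 8 ≤ Mh) (hR : 3 * (ℓ + 1) ≤ R) {x x' : Site (PV d ℓ m K hd hL) 0}
    (hx : blkOf (Dch D c) (toBox hN x) ∈ Qbig (Dch D c) (cc D hMh1 hP4 c)) (hnear : dist (toR (toBox hN x').1) (toR (toBox hN x).1) ≤ 1) :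
    chiS hN hMh1 hP4 c x' = 1 :=
  chiB_eq_one_of_near_Qbig hMh1 hP4 c hM8 hR hx hnear

/-- (χ2) `χ_□ = 1` on the sites of the `□̃`-blocks. [cite: Balaban1984PropagatorsII, p.239] -/
theorem chiS_eq_one_of_mem_Qbig (hM8 : 8 ≤ Mh) (hR : 3 * (ℓ + 1) ≤ R) {x : Site (PV d ℓ m K hd hL) 0}
    (hx : blkOf (Dch D c) (toBox hN x) ∈ Qbig (Dch D c) (cc D hMh1 hP4 c)) : chiS hN hMh1 hP4 c x = 1 :=
  chiB_eq_one_of_near_Qbig hMh1 hP4 c hM8 hR hx (by rw [dist_self]; exact zero_le_one)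

/-- (χ2) `χ_□ = 1` at the forward neighbours of the sites of the `□̃`-blocks (`P_μ ≥ 5`). [cite: Balaban1984PropagatorsII, p.239] -/
theorem chiS_shift_eq_one_of_mem_Qbig (hM8 : 8 ≤ Mh) (hR : 3 * (ℓ + 1) ≤ R) (hP5 : ∀ μ, 5 ≤ P' μ) {x : Site (PV d ℓ m K hd hL) 0}
    (hx : blkOf (Dch D c) (toBox hN x) ∈ Qbig (Dch D c) (cc D hMh1 hP4 c)) (μ : Fin (d + 1)) : chiS hN hMh1 hP4 c (x.shift μ) = 1 := by
  rw [chiS_eq_chiB, toBox_shift hN]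
  exact chiB_eq_one_of_near_Qbig hMh1 hP4 c hM8 hR hx (dist_toR_tshift_le_one (interior_of_mem_Qbig hMh1 hP4 c hM8 hR hP5 hx) μ).1

/-- (χ2) `χ_□ = 1` at the backward neighbours of the sites of the `□̃`-blocks (`P_μ ≥ 5`). [cite: Balaban1984PropagatorsII, p.239] -/
theorem chiS_unshift_eq_one_of_mem_Qbig (hM8 : 8 ≤ Mh) (hR : 3 * (ℓ + 1) ≤ R) (hP5 : ∀ μ, 5 ≤ P' μ) {x : Site (PV d ℓ m K hd hL) 0}
    (hx : blkOf (Dch D c) (toBox hN x) ∈ Qbig (Dch D c) (cc D hMh1 hP4 c)) (μ : Fin (d + 1)) : chiS hN hMh1 hP4 c (x.unshift μ) = 1 := by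
  rw [chiS_eq_chiB, toBox_unshift hN]
  exact chiB_eq_one_of_near_Qbig hMh1 hP4 c hM8 hR hx (dist_toR_tshift_le_one (interior_of_mem_Qbig hMh1 hP4 c hM8 hR hP5 hx) μ).2

/-- (χ3, radius form) `χ ≠ 0 ⇒` the box point is within `35S/16` of the centre. [cite: Balaban1984PropagatorsII, p.239 («equal to 0 outside a similar cube»)] -/
theorem dist_lt_of_chiS_ne_zero {x : Site (PV d ℓ m K hd hL) 0} (h : chiS hN hMh1 hP4 c x ≠ 0) :
    dist (toR (toBox hN x).1) (ctr (Dch D c) (cc D hMh1 hP4 c)) < 35 / 16 * (bigSide ℓ Mh c.1.1 : ℝ) := by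
  have hd := dist_lt_of_chiR_ne_zero (Dch D c) hMh1 h
  rwa [side_cc] at hd

/-- `S_j ≥ 8L` for `M_h ≥ 8`, `j ≥ 1`… in fact for every `j`: `S_j = M_h L^{j+1} ≥ 8L`. [folklore] -/
private theorem eight_L_le_bigSide (hM8 : 8 ≤ Mh) (j : ℕ) : 8 * ((ℓ : ℝ) + 1) ≤ (bigSide ℓ Mh j : ℝ) := by
  have h : 8 * (ℓ + 1) ≤ bigSide ℓ Mh j := by
    unfold bigSide
    exact Nat.mul_le_mul hM8 (by
      calc ℓ + 1 = (ℓ + 1) ^ 1 := (pow_one _).symm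
        _ ≤ (ℓ + 1) ^ (j + 1) := Nat.pow_le_pow_right (Nat.succ_pos ℓ) (by omega))
  exact_mod_cast h

include hMha in
/-- a site whose box point is within `35S/16 + 1` of the centre is `2`-deep in the member window, one within `35S/16` is `3`-deep (`L ≥ 5`, `M_h ≥ 8`:
`35S/16 + 3 ≤ 5S/2 ≤ LS/2`). [cite: Balaban1984PropagatorsII, p.238 (□ ⊂ □̃ ⊂ □̃² ⊂ □̃³ = T_□), p.239, bookkeeping] -/
theorem deepS_of_dist_ctr (hM8 : 8 ≤ Mh) (hL5 : 5 ≤ ℓ + 1) {r : ℕ} {x : Site (PV d ℓ m K hd hL) 0}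
    (h : dist (toR (toBox hN x).1) (ctr (Dch D c) (cc D hMh1 hP4 c)) + r < 35 / 16 * (bigSide ℓ Mh c.1.1 : ℝ) + 3) :
    x ∈ DeepS (bare d ℓ hd hL (eC a c.1.1) 0 (j0 hMh1 hP4 c) (j0_hj hMh1 hP4 c a) ha) (x0 ℓ Mh k c.1) r := by
  refine deep_of_dist_le hN hMh1 hP4 hMha c (j0_hj hMh1 hP4 c a) ha ?_
  have hS := eight_L_le_bigSide (ℓ := ℓ) hM8 c.1.1
  have hl : (5 : ℝ) ≤ (ℓ : ℝ) + 1 := by exact_mod_cast hL5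
  have hS0 : (0 : ℝ) ≤ (bigSide ℓ Mh c.1.1 : ℝ) := by positivity
  have h5 : 5 * (bigSide ℓ Mh c.1.1 : ℝ) ≤ ((ℓ : ℝ) + 1) * (bigSide ℓ Mh c.1.1 : ℝ) := by nlinarith
  linarith

include hMha in
/-- **(χ3) THE SUPPORT OF `χ_□` IS `3`-DEEP IN THE MEMBER WINDOW** (`L ≥ 5`, `M_h ≥ 8`): `χ(x) ≠ 0 ⇒ x ∈ DeepS(t_□, x₀(□), 3)`.
[cite: Balaban1984PropagatorsII, p.238 (□ ⊂ □̃ ⊂ □̃² ⊂ □̃³ = T_□), p.239 («equal to 0 outside a similar cube»)] -/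
theorem deepS_three_of_chiS_ne_zero (hM8 : 8 ≤ Mh) (hL5 : 5 ≤ ℓ + 1) {x : Site (PV d ℓ m K hd hL) 0} (h : chiS hN hMh1 hP4 c x ≠ 0) :
    x ∈ DeepS (bare d ℓ hd hL (eC a c.1.1) 0 (j0 hMh1 hP4 c) (j0_hj hMh1 hP4 c a) ha) (x0 ℓ Mh k c.1) 3 := by
  have hd := dist_lt_of_chiS_ne_zero hN hMh1 hP4 c h
  exact deepS_of_dist_ctr hN hMh1 hP4 hMha c ha hM8 hL5 (by push_cast; linarith)

include hMha in
/-- (χ3) a site within box distance `1` of a carrier of `χ_□` is `2`-deep. [cite: Balaban1984PropagatorsII, p.238–239, bookkeeping] -/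
theorem deepS_two_of_near_carrier (hM8 : 8 ≤ Mh) (hL5 : 5 ≤ ℓ + 1) {x x' : Site (PV d ℓ m K hd hL) 0} (h : chiS hN hMh1 hP4 c x ≠ 0)
    (hnear : dist (toR (toBox hN x').1) (toR (toBox hN x).1) ≤ 1) :
    x' ∈ DeepS (bare d ℓ hd hL (eC a c.1.1) 0 (j0 hMh1 hP4 c) (j0_hj hMh1 hP4 c a) ha) (x0 ℓ Mh k c.1) 2 := by
  have hd := dist_lt_of_chiS_ne_zero hN hMh1 hP4 c h
  refine deepS_of_dist_ctr hN hMh1 hP4 hMha c ha hM8 hL5 ?_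
  push_cast
  linarith [dist_triangle (toR (toBox hN x').1) (toR (toBox hN x).1) (ctr (Dch D c) (cc D hMh1 hP4 c))]

include hMha in
/-- **(χ3) JUMPS OF `χ_□` HAPPEN AT `2`-DEEP BONDS**: `χ(b₊) ≠ χ(b₋) ⇒ b₋ ∈ DeepS(t_□, x₀(□), 2)` (one endpoint carries `χ`, hence is `3`-deep and interior;
the other is its lattice neighbour). [cite: Balaban1984PropagatorsII, p.238–239, bookkeeping] -/
theorem deepS_two_of_chiS_jump (hM8 : 8 ≤ Mh) (hL5 : 5 ≤ ℓ + 1) (hP5 : ∀ μ, 5 ≤ P' μ) (b : PBond (PV d ℓ m K hd hL) 0)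
    (h : chiS hN hMh1 hP4 c b.tgt ≠ chiS hN hMh1 hP4 c b.src) :
    b.src ∈ DeepS (bare d ℓ hd hL (eC a c.1.1) 0 (j0 hMh1 hP4 c) (j0_hj hMh1 hP4 c a) ha) (x0 ℓ Mh k c.1) 2 := by
  by_cases hs : chiS hN hMh1 hP4 c b.src ≠ 0
  · exact deepS_mono (by norm_num) (deepS_three_of_chiS_ne_zero hN hMh1 hP4 hMha c ha hM8 hL5 hs)
  · push Not at hs
    have ht : chiS hN hMh1 hP4 c b.tgt ≠ 0 := by rw [hs] at h; exact h
    have hint : Interior (N0 ℓ Mh k P') (toBox hN b.tgt) := interior_of_chiB_ne_zero hMh1 hP4 c hM8 hP5 ht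
    have e : toBox hN b.src = tshift (N0 ℓ Mh k P') (-unitVec b.dir) (toBox hN b.tgt) := by
      rw [← toBox_unshift hN]
      show toBox hN b.src = toBox hN ((b.src.shift b.dir).unshift b.dir)
      rw [unshift_shift]
    refine deepS_two_of_near_carrier hN hMh1 hP4 hMha c ha hM8 hL5 ht ?_
    rw [e]
    exact (dist_toR_tshift_le_one hint b.dir).2

include hMha in
/-- (χ3) in p22's shape: `χ(b₊) ≠ χ(b₋) ⇒ b₋ ∈ DeepS(t_□, x₀(□), 1)`. [cite: Balaban1984PropagatorsII, p.238–239, bookkeeping] -/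
theorem deepS_one_of_chiS_jump (hM8 : 8 ≤ Mh) (hL5 : 5 ≤ ℓ + 1) (hP5 : ∀ μ, 5 ≤ P' μ) (b : PBond (PV d ℓ m K hd hL) 0)
    (h : chiS hN hMh1 hP4 c b.tgt ≠ chiS hN hMh1 hP4 c b.src) :
    b.src ∈ DeepS (bare d ℓ hd hL (eC a c.1.1) 0 (j0 hMh1 hP4 c) (j0_hj hMh1 hP4 c a) ha) (x0 ℓ Mh k c.1) 1 :=
  deepS_mono (by norm_num) (deepS_two_of_chiS_jump hN hMh1 hP4 hMha c ha hM8 hL5 hP5 b h)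

/-- **(χ4) `|χ_□(x) − χ_□(x + e_μ)| ≤ D1 θ/(5S/2)`** for every V1 site `x` and axis `μ` (through the chart: `toBox (x + e_μ) = σ_{e_μ}(toBox x)`).
[cite: Balaban1984PropagatorsII, p.239 (ζ_□ «of the same type as h_□»), p.229; Balaban1983RegularityDecay, §2 p.577 (first-difference sizes of such cut-offs)] -/
theorem abs_chiS_sub_shift_le (hM8 : 8 ≤ Mh) (hP5 : ∀ μ, 5 ≤ P' μ) (μ : Fin (d + 1)) (x : Site (PV d ℓ m K hd hL) 0) :
    |chiS hN hMh1 hP4 c x - chiS hN hMh1 hP4 c (x.shift μ)| ≤ D1 thetaProf / (5 / 2 * (bigSide ℓ Mh c.1.1 : ℝ)) := by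
  rw [chiS_eq_chiB, chiS_eq_chiB, toBox_shift hN]
  exact abs_chiB_sub_tshift_le hMh1 hP4 c hM8 hP5 μ _

/-- **(χ4) `|χ_□(x) − χ_□(x − e_μ)| ≤ D1 θ/(5S/2)`.** [cite: Balaban1984PropagatorsII, p.239, p.229] -/
theorem abs_chiS_sub_unshift_le (hM8 : 8 ≤ Mh) (hP5 : ∀ μ, 5 ≤ P' μ) (μ : Fin (d + 1)) (x : Site (PV d ℓ m K hd hL) 0) :
    |chiS hN hMh1 hP4 c x - chiS hN hMh1 hP4 c (x.unshift μ)| ≤ D1 thetaProf / (5 / 2 * (bigSide ℓ Mh c.1.1 : ℝ)) := by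
  rw [chiS_eq_chiB, chiS_eq_chiB, toBox_unshift hN]
  exact abs_chiB_sub_tshift_neg_le hMh1 hP4 c hM8 hP5 μ _

/-- (χ4) on bonds: `|χ_□(b₊) − χ_□(b₋)| ≤ D1 θ/(5S/2)`. [cite: Balaban1984PropagatorsII, p.239, p.229] -/
theorem abs_chiS_tgt_sub_src_le (hM8 : 8 ≤ Mh) (hP5 : ∀ μ, 5 ≤ P' μ) (b : PBond (PV d ℓ m K hd hL) 0) :
    |chiS hN hMh1 hP4 c b.tgt - chiS hN hMh1 hP4 c b.src| ≤ D1 thetaProf / (5 / 2 * (bigSide ℓ Mh c.1.1 : ℝ)) := by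
  rw [abs_sub_comm]
  exact abs_chiS_sub_shift_le hN hMh1 hP4 c hM8 hP5 b.dir b.src

/-- **(χ5) `|χ_□(x + e_μ) − 2χ_□(x) + χ_□(x − e_μ)| ≤ D2 θ/(5S/2)²`** for every V1 site `x` and axis `μ`.
[cite: Balaban1984PropagatorsII, p.239 (ζ_□ «of the same type as h_□»), p.229; Balaban1983RegularityDecay, §2 p.577 (second-difference sizes of such cut-offs)] -/
theorem abs_chiS_second_le (hM8 : 8 ≤ Mh) (hP5 : ∀ μ, 5 ≤ P' μ) (μ : Fin (d + 1)) (x : Site (PV d ℓ m K hd hL) 0) :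
    |chiS hN hMh1 hP4 c (x.shift μ) - 2 * chiS hN hMh1 hP4 c x + chiS hN hMh1 hP4 c (x.unshift μ)|
      ≤ D2 thetaProf / (5 / 2 * (bigSide ℓ Mh c.1.1 : ℝ)) ^ 2 := by
  rw [chiS_eq_chiB, chiS_eq_chiB, chiS_eq_chiB, toBox_shift hN, toBox_unshift hN]
  exact abs_chiB_second_le hMh1 hP4 c hM8 hP5 μ _

/-- the constants are nonnegative: `0 ≤ D1 θ`, `0 ≤ D2 θ`. [cite: Balaban1983RegularityDecay, §2 p.577, bookkeeping] -/
theorem D1_D2_thetaProf_nonneg : 0 ≤ D1 thetaProf ∧ 0 ≤ D2 thetaProf :=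
  ⟨D1_nonneg contDiff_thetaProf hasCompactSupport_thetaProf, D2_nonneg contDiff_thetaProf hasCompactSupport_thetaProf⟩

end Sites

end Literature.MathematicalPhysics.QuantumFieldTheory.Balaban1983to89.B6Line3ChiCutoffV1

end
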